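import Mathlib
import Summits.NavierStokesRegularity.NavierStokesRegularity.Theorems.EulerZoomLiouvillePowerGaugeEulerLiouvilleAnchoredBudgetLocalFloor
import Summits.NavierStokesRegularity.NavierStokesRegularity.Theorems.EulerZoomLiouvillePowerGaugeEulerLiouvilleAnchoredBudgetMember
import HarnessLib

/-!
# Crux `EulerZoomLiouville.PowerGaugeEulerLiouville` (stmt-NavierStokesRegularity-19832), line `anchored-budget` REV3:
# THE CLAUSE-FREE STRATUM `IsAnchoredBudgeted` IS TRIVIAL — unconditional, by name

Route №10 `EulerZoomLiouville` (NavierStokesRegularity), crux E.  Line `anchored-budget` (ideator ns-idea-11 g4;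
`Cruxes/PowerGaugeEulerLiouville/Lines/anchored_budget.lean`, REV3 = text of record, critic V37b: «stratum grade — envelope-free and flow-clause-free;
thin w.r.t. SS needle»).  With the rev3 C1 landed (`anchoredFloorTransport_rev3`, `…AnchoredBudgetLocalFloor`, seat ns-sfl-p1 g4) the conditional
stratum theorem of ns-ezl-w2 g2 (`anchoredBudgeted_ae_eq_zero_of_floorTransport`, `…AnchoredBudgetMember`: C1 ∘ C2 `anchoredStarvation` ∘ the lead's
`PastIrrotational.ae_eq_zero_of_gauge_of_pastIrrotational` / `powerGaugeEulerLiouville_largeRho`) becomes UNCONDITIONAL: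

* `anchoredBudgeted_ae_eq_zero_rev3` — **THE rev3 STRATUM**: for every `ρ > 0`, a member of Seregin's power-gauged ancient Euler class whose far past
  `(−∞,T₁)`, `T₁ ≤ 0`, is CLASSICAL — nothing else: NO velocity envelope, NO Lipschitz/flow clause — and carries a stretching budget
  `⟪∇u ω, ω⟫ ≤ (K/(−τ) + Λ(τ))|ω|²`, `Λ ≥ 0` integrable, `0 ≤ K < ρ/(1+ρ)`, vanishes a.e. on the past slab (= the line's `InClass → IsAnchoredBudgeted ρ u p →
  VanishesAE u`, δ-unfolded; one-name filler for the LEAD);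
* `anchoredBudgeted_K0_ae_eq_zero_rev3` — the quotable `K = 0` member (critic V37 P2), clause-free: a classical far past along which `|ω| e^{−∫Λ}` is
  non-increasing forward on every trajectory ⇒ trivial;
* `integrableLipschitz_ae_eq_zero` — «BKM AT −∞», clause-free: a member whose far past is classical with Lipschitz modulus INTEGRABLE at `−∞`
  (`‖∇u(τ)‖_∞ ≤ Λ(τ)`, `∫_{(−∞,T₁)} Λ < ∞`) is trivial, for every `ρ > 0` — no fading of the vorticity, no envelope.

WHAT THIS IS NOT: not NS regularity, not the crux E — STRATUM theorems `--supports` stmt-19832 about a hypothetical Euler zoom-limit class (MODEL lattice);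
the residue C3 `stub_anchoredRest` (weak members; classical members with larger budgets), crux 19832 and NS regularity stay OPEN; nothing is wired into the
lead's skeleton by this seat.
[cite: CrippaDeLellis2008, §2–3; CaffarelliKohnNirenberg1982, §2; MajdaBertozziCUP2002, §1.6]
-/

noncomputable section

set_option linter.dupNamespace false

open MeasureTheory Set Filter Topology Metric Function
open scoped NNReal ENNReal RealInnerProductSpace

namespace Summit.NavierStokesRegularity.NavierStokesRegularity.Theorems.PowerGaugeEulerLiouville.AnchoredBudget

open Literature.Analysis Literature.Analysis.FluidPDE

/-- **THE rev3 STRATUM `IsAnchoredBudgeted` IS TRIVIAL (unconditional, clause-free).**  For every `ρ > 0`: a member of Seregin's power-gauged ancient Euler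
class whose far past `(−∞,T₁)` (`T₁ ≤ 0`) is CLASSICAL and carries a stretching budget `⟪∇u ω, ω⟫ ≤ (K/(−τ) + Λ(τ))|ω|²`, `Λ ≥ 0` integrable,
`0 ≤ K < ρ/(1+ρ)`, vanishes a.e. on the past slab.  No velocity envelope, no flow clause: the members may be intermittent, with spatially unbounded
velocity and gradient, as far as the gauges allow.  (`anchoredBudgeted_ae_eq_zero_of_floorTransport anchoredFloorTransport_rev3`.)
[cite: CrippaDeLellis2008, §2–3; CaffarelliKohnNirenberg1982, §2] -/
theorem anchoredBudgeted_ae_eq_zero_rev3 :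
    ∀ ρ : ℝ, 0 < ρ → ∀ (u : ℝ → EuclideanSpace ℝ (Fin 3) → EuclideanSpace ℝ (Fin 3))
      (p : ℝ → EuclideanSpace ℝ (Fin 3) → ℝ)
      (H : ℝ → EuclideanSpace ℝ (Fin 3) → EuclideanSpace ℝ (Fin 3) →L[ℝ] EuclideanSpace ℝ (Fin 3)) (c : ℝ≥0),
      (IsSuitableWeakSolutionOn (slab (EuclideanSpace ℝ (Fin 3)) (Set.Iio 0) isOpen_Iio) 0 0 u p ∧
        HasWeakSpatialGradientOn (slab (EuclideanSpace ℝ (Fin 3)) (Set.Iio 0) isOpen_Iio) u H ∧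
        (∀ a : ℝ, 0 < a →
          ENNReal.ofReal (a ^ (2 * ρ)) * cknA a (0 : ℝ × EuclideanSpace ℝ (Fin 3)) u +
              ENNReal.ofReal (a ^ ρ) * cknE a (0 : ℝ × EuclideanSpace ℝ (Fin 3)) H +
            ENNReal.ofReal (a ^ (2 * ρ)) * cknD a (0 : ℝ × EuclideanSpace ℝ (Fin 3)) p ≤ (c : ℝ≥0∞))) →
      (∃ (T₁ K : ℝ) (Λ : ℝ → ℝ),
        (IsClassicalEulerSolutionOn (Set.Iio 0) 0 u p ∧ T₁ ≤ 0) ∧ 0 ≤ K ∧ K < ρ / (1 + ρ) ∧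
        (IntegrableOn Λ (Set.Iio T₁) ∧ (∀ τ : ℝ, 0 ≤ Λ τ) ∧
          ∀ τ : ℝ, τ < T₁ → ∀ x : EuclideanSpace ℝ (Fin 3),
            ⟪fderiv ℝ (u τ) x (curl (u τ) x), curl (u τ) x⟫ ≤ (K / (-τ) + Λ τ) * ‖curl (u τ) x‖ ^ 2)) →
      Function.uncurry u =ᵐ[volume.restrict (Set.Iio (0 : ℝ) ×ˢ (Set.univ : Set (EuclideanSpace ℝ (Fin 3))))] 0 :=
  anchoredBudgeted_ae_eq_zero_of_floorTransport anchoredFloorTransport_rev3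

/-- **THE QUOTABLE `K = 0` MEMBER (critic V37 P2), clause-free and unconditional:** for every `ρ > 0`, a member of the power-gauged class with a CLASSICAL far
past `(−∞,T₁)`, `T₁ ≤ 0`, along which `⟪∇u ω, ω⟫ ≤ Λ(τ)|ω|²` with `Λ ≥ 0` integrable (so `|ω| e^{−∫Λ}` is non-increasing forward on every trajectory)
vanishes a.e. [cite: CrippaDeLellis2008, §2–3] -/
theorem anchoredBudgeted_K0_ae_eq_zero_rev3 :
    ∀ ρ : ℝ, 0 < ρ → ∀ (u : ℝ → EuclideanSpace ℝ (Fin 3) → EuclideanSpace ℝ (Fin 3))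
      (p : ℝ → EuclideanSpace ℝ (Fin 3) → ℝ)
      (H : ℝ → EuclideanSpace ℝ (Fin 3) → EuclideanSpace ℝ (Fin 3) →L[ℝ] EuclideanSpace ℝ (Fin 3)) (c : ℝ≥0),
      (IsSuitableWeakSolutionOn (slab (EuclideanSpace ℝ (Fin 3)) (Set.Iio 0) isOpen_Iio) 0 0 u p ∧
        HasWeakSpatialGradientOn (slab (EuclideanSpace ℝ (Fin 3)) (Set.Iio 0) isOpen_Iio) u H ∧
        (∀ a : ℝ, 0 < a →
          ENNReal.ofReal (a ^ (2 * ρ)) * cknA a (0 : ℝ × EuclideanSpace ℝ (Fin 3)) u +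
              ENNReal.ofReal (a ^ ρ) * cknE a (0 : ℝ × EuclideanSpace ℝ (Fin 3)) H +
            ENNReal.ofReal (a ^ (2 * ρ)) * cknD a (0 : ℝ × EuclideanSpace ℝ (Fin 3)) p ≤ (c : ℝ≥0∞))) →
      ∀ (T₁ : ℝ) (Λ : ℝ → ℝ), IsClassicalEulerSolutionOn (Set.Iio 0) 0 u p → T₁ ≤ 0 →
        IntegrableOn Λ (Set.Iio T₁) → (∀ τ : ℝ, 0 ≤ Λ τ) →
        (∀ τ : ℝ, τ < T₁ → ∀ x : EuclideanSpace ℝ (Fin 3),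
          ⟪fderiv ℝ (u τ) x (curl (u τ) x), curl (u τ) x⟫ ≤ Λ τ * ‖curl (u τ) x‖ ^ 2) →
        Function.uncurry u =ᵐ[volume.restrict (Set.Iio (0 : ℝ) ×ˢ (Set.univ : Set (EuclideanSpace ℝ (Fin 3))))] 0 := by
  intro ρ hρ u p H c hcls T₁ Λ hcl hT₁ hΛi hΛ0 hbud
  have hthr : (0 : ℝ) < ρ / (1 + ρ) := div_pos hρ (by linarith)
  refine anchoredBudgeted_ae_eq_zero_rev3 ρ hρ u p H c hcls ⟨T₁, 0, Λ, ⟨hcl, hT₁⟩, le_rfl, hthr, hΛi, hΛ0, fun τ hτ x => ?_⟩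
  rw [zero_div, zero_add]
  exact hbud τ hτ x

/-- **«BKM AT −∞», clause-free and unconditional:** for every `ρ > 0`, a member of the power-gauged class with a CLASSICAL far past `(−∞,T₁)`, `T₁ ≤ 0`,
whose LIPSCHITZ MODULUS IS INTEGRABLE AT `−∞` — `‖∇u(τ,x)‖ ≤ Λ(τ)` for `τ < T₁`, `Λ ≥ 0`, `∫_{(−∞,T₁)} Λ < ∞` — vanishes a.e.
(`⟪∇u ω, ω⟫ ≤ ‖∇u‖|ω|² ≤ Λ|ω|²` is the budget `(0, Λ)`.)  NO fading of the vorticity is assumed (compare the lead's `VorticityBirth` stratum, which needs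
`e^{∫_s^T Λ} sup|curl u(s)| → 0` as `s → −∞`): the permanent floor is killed by the GAUGES through anchoring (C1) and enstrophy starvation (C2).
[cite: CrippaDeLellis2008, §2–3; MajdaBertozziCUP2002, §1.6] -/
theorem integrableLipschitz_ae_eq_zero :
    ∀ ρ : ℝ, 0 < ρ → ∀ (u : ℝ → EuclideanSpace ℝ (Fin 3) → EuclideanSpace ℝ (Fin 3))
      (p : ℝ → EuclideanSpace ℝ (Fin 3) → ℝ)
      (H : ℝ → EuclideanSpace ℝ (Fin 3) → EuclideanSpace ℝ (Fin 3) →L[ℝ] EuclideanSpace ℝ (Fin 3)) (c : ℝ≥0),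
      (IsSuitableWeakSolutionOn (slab (EuclideanSpace ℝ (Fin 3)) (Set.Iio 0) isOpen_Iio) 0 0 u p ∧
        HasWeakSpatialGradientOn (slab (EuclideanSpace ℝ (Fin 3)) (Set.Iio 0) isOpen_Iio) u H ∧
        (∀ a : ℝ, 0 < a →
          ENNReal.ofReal (a ^ (2 * ρ)) * cknA a (0 : ℝ × EuclideanSpace ℝ (Fin 3)) u +
              ENNReal.ofReal (a ^ ρ) * cknE a (0 : ℝ × EuclideanSpace ℝ (Fin 3)) H +
            ENNReal.ofReal (a ^ (2 * ρ)) * cknD a (0 : ℝ × EuclideanSpace ℝ (Fin 3)) p ≤ (c : ℝ≥0∞))) →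
      ∀ (T₁ : ℝ) (Λ : ℝ → ℝ), IsClassicalEulerSolutionOn (Set.Iio 0) 0 u p → T₁ ≤ 0 →
        IntegrableOn Λ (Set.Iio T₁) → (∀ τ : ℝ, 0 ≤ Λ τ) →
        (∀ τ : ℝ, τ < T₁ → ∀ x : EuclideanSpace ℝ (Fin 3), ‖fderiv ℝ (u τ) x‖ ≤ Λ τ) →
        Function.uncurry u =ᵐ[volume.restrict (Set.Iio (0 : ℝ) ×ˢ (Set.univ : Set (EuclideanSpace ℝ (Fin 3))))] 0 := by
  intro ρ hρ u p H c hcls T₁ Λ hcl hT₁ hΛi hΛ0 hLip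
  refine anchoredBudgeted_K0_ae_eq_zero_rev3 ρ hρ u p H c hcls T₁ Λ hcl hT₁ hΛi hΛ0 fun τ hτ x => ?_
  have hcs : ⟪fderiv ℝ (u τ) x (curl (u τ) x), curl (u τ) x⟫ ≤
      ‖fderiv ℝ (u τ) x (curl (u τ) x)‖ * ‖curl (u τ) x‖ := real_inner_le_norm _ _
  have hop : ‖fderiv ℝ (u τ) x (curl (u τ) x)‖ ≤ ‖fderiv ℝ (u τ) x‖ * ‖curl (u τ) x‖ :=
    ContinuousLinearMap.le_opNorm _ _
  have hn : 0 ≤ ‖curl (u τ) x‖ := norm_nonneg _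
  calc ⟪fderiv ℝ (u τ) x (curl (u τ) x), curl (u τ) x⟫
      ≤ ‖fderiv ℝ (u τ) x‖ * ‖curl (u τ) x‖ * ‖curl (u τ) x‖ := hcs.trans (by gcongr)
    _ ≤ Λ τ * ‖curl (u τ) x‖ * ‖curl (u τ) x‖ := by gcongr; exact hLip τ hτ x
    _ = Λ τ * ‖curl (u τ) x‖ ^ 2 := by ring

end Summit.NavierStokesRegularity.NavierStokesRegularity.Theorems.PowerGaugeEulerLiouville.AnchoredBudget

end
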